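import Literature.NumberTheory.LocalFields.UnramifiedQuadraticNormSurjective
import Mathlib.RingTheory.Ideal.Norm.AbsNorm
import Mathlib.RingTheory.DiscreteValuationRing.Basic
import Literature.NumberTheory.GaloisRepresentations.CompleteLocalFiniteLevels   -- ★ `CompleteLocalRing.finite_quotient_maximalIdeal_pow`
import HarnessLib

/-!
# The `σ̄`-fixed points of `R ⧸ 𝔪^k` for an unramified quadratic involution of a discrete valuation ring: `|Fix(σ̄_k)| = q^k`
# (Serre, *Local Fields*, Ch. V §2, Prop. 2–3; FILE 1 of the norm-fibre count behind Flicker 1998 §6 p. 95)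

Topic `NumberTheory/LocalFields`, namespace `Literature.NumberTheory.LocalFields.UnramifiedQuadraticNorm` (as ★
`UnramifiedQuadraticNormSurjective`).  THEOREMS ONLY: no definition, no named fact, no instance, no notation, no `sorry`.  Cell
`pub/hodgecm-mathlib`, F0∕P3a road «D-N7-inert», brick (L5-c) FILE 1 of the H-side count (L5) [Flicker1998UnitaryFL §6 p. 95 + REMARK]
(B-p10 (g24) PRE-CENSUS bf72064b4f0257e1).  HC_CM is proved only modulo the printed citations until rung 0 closes; nothing printed is a
letter here — this is elementary finite counting.  FILE 2 (`UnramifiedQuadraticNormFibres`) adds units, fixed units and the norm fibres.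

SETTING.  `R` a commutative ring with a ring involution `σ` (`σ ∘ σ = id`) moving some element by a unit (`σ a − a ∈ Rˣ`, i.e. `σ̄ ≠ id`); from §1 on `R`
is a discrete valuation ring (`𝔪` principal), in §3 with `|𝓀| = q²`.  Model: `R = 𝒪_w`, `σ = σ_w` at a non-split unramified place `w ∣ v` of a CM field,
`q = |𝓀_v|`.  NO uniformiser is chosen and none needs to be `σ`-fixed: `σ(𝔪) = 𝔪` is automatic for an involution of a local ring.

* §0 `σ(𝔪^k) ⊆ 𝔪^k`; the descended involution `σ̄_k = Ideal.quotientMap (𝔪^k) σ _` (`quotientMap_mk`, `quotientMap_quotientMap`).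
* §1 `|R ⧸ 𝔪^k| = |𝓀|^k` (Mathlib `cardQuot_pow_of_prime`; finiteness is ★ `CompleteLocalRing.finite_quotient_maximalIdeal_pow`).
* §2 THE `R^σ`-COORDINATES: with `θ = σ a − a` (a unit, `σ θ = −θ`), every `x` is `u(x) + v(x)·a` with `v(x) = (σx − x)θ⁻¹`, `u(x) = x − v(x) a`
  BOTH `σ`-FIXED (`map_vCoord`, `map_uCoord`), uniquely (`vCoord_unique`, `vCoord_add_mul`, `uCoord_add_mul`) — «`R = R^σ ⊕ R^σ a`»; and every
  `σ̄`-fixed class modulo an ideal `I ⊇ σ(I)` has a `σ`-FIXED representative `x + t(σx − x)`, `t + σ t = 1` (`exists_fixed_sub_mem`, ★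
  `exists_add_map_eq_one_of_isUnit_sub`).
* §3 COUNTING: **`natCard_quotient_eq_natCard_fixed_sq`** —
  `|R ⧸ I| = |Fix(σ̄_I)|²` for every ideal `I ⊇ σ(I)` (the bijection `(y, z) ↦ y + z ā` from pairs of fixed classes); hence for a DVR with `|𝓀| = q²`
  **`natCard_fixed_quotient_pow`**: `|Fix(σ̄_k)| = q^k` (`q^{2k}` is the square of `|Fix|`).

## References
* [Serre1979] J.-P. Serre, *Local Fields*, GTM 67 (1979), Ch. V §2 Prop. 1–3 and Corollary (the unramified case), Ch. II §3 Prop. 5.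
* [Flicker1998UnitaryFL] Y. Z. Flicker, *Elementary proof of the fundamental lemma for a unitary group*, Canad. J. Math. 50 (1998), §6 p. 95 and REMARK.
-/

set_option autoImplicit false

namespace Literature.NumberTheory.LocalFields.UnramifiedQuadraticNorm

open Literature.LinearAlgebra.Matrix.HermitianFormsHensel Literature.NumberTheory.GaloisRepresentations IsLocalRing

universe u

variable {R : Type u} [CommRing R] (σ : R →+* R)

/-! ## §0 The involution descends to `R ⧸ 𝔪^k` -/

section Descend

variable [IsLocalRing R]

/-- `σ(𝔪^k) ⊆ 𝔪^k` for a ring endomorphism `σ` of a local ring with `σ ∘ σ = id`. [cite: Serre1979, Ch. V §2 Prop. 1] -/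
theorem map_mem_maximalIdeal_pow (hσ : ∀ a, σ (σ a) = a) (k : ℕ) :
    ∀ a ∈ maximalIdeal R ^ k, σ a ∈ maximalIdeal R ^ k := by
  intro a ha
  have h : Ideal.map σ (maximalIdeal R ^ k) ≤ maximalIdeal R ^ k := by
    rw [Ideal.map_pow]
    refine Ideal.pow_right_mono ?_ k
    rw [Ideal.map_le_iff_le_comap]
    intro b hb
    exact map_mem_maximalIdeal σ hσ b hb
  exact h (Ideal.mem_map_of_mem σ ha)

/-- The comparison `𝔪^k ≤ comap σ (𝔪^k)` that makes `σ` descend to `R ⧸ 𝔪^k` (Mathlib `Ideal.quotientMap`). [cite: Serre1979, Ch. V §2 Prop. 1] -/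
theorem maximalIdeal_pow_le_comap (hσ : ∀ a, σ (σ a) = a) (k : ℕ) :
    maximalIdeal R ^ k ≤ (maximalIdeal R ^ k).comap σ := fun a ha =>
  Ideal.mem_comap.2 (map_mem_maximalIdeal_pow σ hσ k a ha)

/-- The descended map `σ̄_k` on representatives: `σ̄_k (x mod 𝔪^k) = σ x mod 𝔪^k`. [cite: Serre1979, Ch. V §2 Prop. 1] -/
theorem quotientMap_mk (hσ : ∀ a, σ (σ a) = a) (k : ℕ) (x : R) :
    Ideal.quotientMap (maximalIdeal R ^ k) σ (maximalIdeal_pow_le_comap σ hσ k) (Ideal.Quotient.mk _ x) = Ideal.Quotient.mk _ (σ x) :=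
  Ideal.quotientMap_mk

/-- `σ̄_k` is again an involution. [cite: Serre1979, Ch. V §2 Prop. 1] -/
theorem quotientMap_quotientMap (hσ : ∀ a, σ (σ a) = a) (k : ℕ) (x : R ⧸ maximalIdeal R ^ k) :
    Ideal.quotientMap (maximalIdeal R ^ k) σ (maximalIdeal_pow_le_comap σ hσ k)
      (Ideal.quotientMap (maximalIdeal R ^ k) σ (maximalIdeal_pow_le_comap σ hσ k) x) = x := by
  obtain ⟨x, rfl⟩ := Ideal.Quotient.mk_surjective x
  rw [quotientMap_mk σ hσ, quotientMap_mk σ hσ, hσ]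

end Descend

/-! ## §1 `|R ⧸ 𝔪^k| = |𝓀|^k` -/

section Card

variable [IsDomain R] [IsDiscreteValuationRing R]

/-- `|R ⧸ 𝔪^k| = |𝓀|^k` for a discrete valuation ring (`𝔪^i ∕ 𝔪^{i+1} ≅ 𝓀`; Mathlib `cardQuot_pow_of_prime`). [cite: Serre1979, Ch. II §3 Prop. 5] -/
theorem natCard_quotient_maximalIdeal_pow (k : ℕ) :
    Nat.card (R ⧸ maximalIdeal R ^ k) = Nat.card (ResidueField R) ^ k := by
  have h := cardQuot_pow_of_prime (S := R) (P := maximalIdeal R) (IsDiscreteValuationRing.not_a_field R) (i := k)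
  rw [Submodule.cardQuot_apply, Submodule.cardQuot_apply] at h
  exact h

end Card

/-! ## §2 The `R^σ`-decomposition `x = u(x) + v(x)·a` and the fixed points of `σ̄_k` -/

section Decomposition

variable (hσ : ∀ a, σ (σ a) = a) {a : R} (ha : IsUnit (σ a - a))

include hσ in
/-- `σ θ = −θ` for `θ = σ a − a`. [cite: Serre1979, Ch. V §2 Prop. 2] -/
theorem map_sub_self_eq_neg (a : R) : σ (σ a - a) = -(σ a - a) := by
  rw [map_sub, hσ, neg_sub]

include hσ in
/-- `σ(θ⁻¹) = −θ⁻¹` for the unit `θ = σ a − a`. [cite: Serre1979, Ch. V §2 Prop. 2] -/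
theorem map_unit_inv_eq_neg : σ (↑(ha.unit⁻¹) : R) = -↑(ha.unit⁻¹) := by
  have h1 : (σ a - a) * ↑(ha.unit⁻¹) = 1 := ha.mul_val_inv
  have h2 : σ (σ a - a) * σ ↑(ha.unit⁻¹) = 1 := by rw [← map_mul, h1, map_one]
  rw [map_sub_self_eq_neg σ hσ, neg_mul, neg_eq_iff_eq_neg] at h2
  calc σ ↑(ha.unit⁻¹) = (↑(ha.unit⁻¹) * (σ a - a)) * σ ↑(ha.unit⁻¹) := by rw [ha.val_inv_mul, one_mul]
    _ = ↑(ha.unit⁻¹) * ((σ a - a) * σ ↑(ha.unit⁻¹)) := by rw [mul_assoc]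
    _ = -↑(ha.unit⁻¹) := by rw [h2, mul_neg, mul_one]

include hσ in
/-- The `σ`-FIXED coordinate `v(x) = (σ x − x)·θ⁻¹` (`θ = σ a − a`): `σ (v x) = v x`. [cite: Serre1979, Ch. V §2 Prop. 2] -/
theorem map_vCoord (x : R) : σ ((σ x - x) * ↑(ha.unit⁻¹)) = (σ x - x) * ↑(ha.unit⁻¹) := by
  rw [map_mul, map_sub, hσ, map_unit_inv_eq_neg σ hσ ha, mul_neg, ← neg_mul, neg_sub]

include hσ in
/-- The other `σ`-FIXED coordinate `u(x) = x − v(x)·a`: `σ (u x) = u x`. [cite: Serre1979, Ch. V §2 Prop. 2] -/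
theorem map_uCoord (x : R) : σ (x - (σ x - x) * ↑(ha.unit⁻¹) * a) = x - (σ x - x) * ↑(ha.unit⁻¹) * a := by
  have hv := map_vCoord σ hσ ha x
  have h1 : (σ x - x) * ↑(ha.unit⁻¹) * (σ a - a) = σ x - x := by
    rw [mul_assoc, ha.val_inv_mul, mul_one]
  rw [map_sub, map_mul, hv]
  have e : (σ x - x) * ↑(ha.unit⁻¹) * σ a = (σ x - x) * ↑(ha.unit⁻¹) * a + (σ x - x) := by
    linear_combination h1
  rw [e]; ring

/-- `x = u(x) + v(x)·a` (trivially). [cite: Serre1979, Ch. V §2 Prop. 2] -/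
theorem uCoord_add_vCoord_mul (x : R) : (x - (σ x - x) * ↑(ha.unit⁻¹) * a) + (σ x - x) * ↑(ha.unit⁻¹) * a = x :=
  sub_add_cancel x _

include ha in
/-- UNIQUENESS of the decomposition: if `u + v·a = u′ + v′·a` with all four `σ`-fixed then `v = v′` (and hence `u = u′`).
[cite: Serre1979, Ch. V §2 Prop. 2] -/
theorem vCoord_unique {u v u' v' : R} (hu : σ u = u) (hv : σ v = v) (hu' : σ u' = u') (hv' : σ v' = v')
    (h : u + v * a = u' + v' * a) : v = v' := by
  have h1 : σ (u + v * a) - (u + v * a) = v * (σ a - a) := by rw [map_add, map_mul, hu, hv]; ring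
  have h2 : σ (u' + v' * a) - (u' + v' * a) = v' * (σ a - a) := by rw [map_add, map_mul, hu', hv']; ring
  have h3 : v * (σ a - a) = v' * (σ a - a) := by rw [← h1, ← h2, h]
  exact (ha.mul_left_inj).1 h3

/-- The coordinates of a `σ`-FIXED combination `y + z·a` (`σ y = y`, `σ z = z`) are `(y, z)`: `v(y + z a) = z`. [cite: Serre1979, Ch. V §2 Prop. 2] -/
theorem vCoord_add_mul {y z : R} (hy : σ y = y) (hz : σ z = z) :
    (σ (y + z * a) - (y + z * a)) * ↑(ha.unit⁻¹) = z := by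
  have h1 : σ (y + z * a) - (y + z * a) = z * (σ a - a) := by rw [map_add, map_mul, hy, hz]; ring
  rw [h1, mul_assoc, ha.mul_val_inv, mul_one]

/-- … and `u(y + z a) = y`. [cite: Serre1979, Ch. V §2 Prop. 2] -/
theorem uCoord_add_mul {y z : R} (hy : σ y = y) (hz : σ z = z) :
    (y + z * a) - (σ (y + z * a) - (y + z * a)) * ↑(ha.unit⁻¹) * a = y := by
  rw [vCoord_add_mul σ ha hy hz, add_sub_cancel_right]

include hσ ha in
/-- **A `σ̄_k`-fixed class has a `σ`-FIXED representative**: if `σ x − x ∈ I` for an ideal with `σ(I) ⊆ I` then `σ r = r` for some `r ≡ x (mod I)`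
(`r = x + t(σx − x)` with `t + σ t = 1`, ★ `exists_add_map_eq_one_of_isUnit_sub`). [cite: Serre1979, Ch. V §2 Prop. 2] -/
theorem exists_fixed_sub_mem [IsLocalRing R] {I : Ideal R} {x : R} (hx : σ x - x ∈ I) : ∃ r : R, σ r = r ∧ r - x ∈ I := by
  obtain ⟨t, ht⟩ := exists_add_map_eq_one_of_isUnit_sub σ hσ ha
  refine ⟨x + t * (σ x - x), ?_, ?_⟩
  · have hst : σ t = 1 - t := by rw [← ht]; ring
    rw [map_add, map_mul, map_sub, hσ, hst]; ring
  · rw [add_sub_cancel_left]; exact I.mul_mem_left t hx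

end Decomposition

/-! ## §3 Counting: `|R ⧸ I| = |Fix(σ̄_I)|²`, `|Fix(σ̄_k)| = q^k` -/


section FixedPoints

variable (hσ : ∀ a, σ (σ a) = a) {a : R} (ha : IsUnit (σ a - a)) {I : Ideal R} (hI : I ≤ I.comap σ)

include hσ ha in
/-- **`|R ⧸ I| = |Fix(σ̄)|²`** for every ideal `I` with `σ(I) ⊆ I`: `(y, z) ↦ y + z·ā` is a bijection `Fix(σ̄) × Fix(σ̄) → R ⧸ I` (onto: `x̄ = ū(x) + v̄(x)·ā` with
`u(x), v(x)` `σ`-fixed; one-to-one: read the coordinates of `σ`-FIXED lifts, `exists_fixed_sub_mem`, `vCoord_add_mul`).  [`R = R^σ ⊕ R^σ a` descends modulo `I`.]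
[cite: Serre1979, Ch. V §2 Prop. 2] -/
theorem natCard_quotient_eq_natCard_fixed_sq [IsLocalRing R] :
    Nat.card (R ⧸ I) = Nat.card {x : R ⧸ I // Ideal.quotientMap I σ hI x = x} ^ 2 := by
  classical
  set σq := Ideal.quotientMap I σ hI with hσq
  have hσq_mk : ∀ x : R, σq (Ideal.Quotient.mk I x) = Ideal.Quotient.mk I (σ x) := fun x => Ideal.quotientMap_mk
  -- the map `Ψ (y, z) = y + z ā`
  let Ψ : {x : R ⧸ I // σq x = x} × {x : R ⧸ I // σq x = x} → R ⧸ I := fun p => p.1.1 + p.2.1 * Ideal.Quotient.mk I a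
  have hΨ : Function.Bijective Ψ := by
    constructor
    · rintro ⟨⟨y, hy⟩, ⟨z, hz⟩⟩ ⟨⟨y', hy'⟩, ⟨z', hz'⟩⟩ h
      simp only [Ψ] at h
      -- σ-fixed lifts
      obtain ⟨y₀, rfl⟩ := Ideal.Quotient.mk_surjective y
      obtain ⟨z₀, rfl⟩ := Ideal.Quotient.mk_surjective z
      obtain ⟨y₀', rfl⟩ := Ideal.Quotient.mk_surjective y'
      obtain ⟨z₀', rfl⟩ := Ideal.Quotient.mk_surjective z'
      have lift : ∀ w : R, σq (Ideal.Quotient.mk I w) = Ideal.Quotient.mk I w → ∃ r : R, σ r = r ∧ Ideal.Quotient.mk I r = Ideal.Quotient.mk I w := by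
        intro w hw
        rw [hσq_mk, Ideal.Quotient.eq] at hw
        obtain ⟨r, hr, hrw⟩ := exists_fixed_sub_mem σ hσ ha hw
        exact ⟨r, hr, (Ideal.Quotient.eq).2 hrw⟩
      obtain ⟨ry, hry, ey⟩ := lift y₀ hy
      obtain ⟨rz, hrz, ez⟩ := lift z₀ hz
      obtain ⟨ry', hry', ey'⟩ := lift y₀' hy'
      obtain ⟨rz', hrz', ez'⟩ := lift z₀' hz'
      rw [← ey, ← ez, ← ey', ← ez', ← map_mul, ← map_mul, ← map_add, ← map_add, Ideal.Quotient.eq] at h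
      -- apply the additive coordinate `v` to the difference
      have hvI : (σ ((ry + rz * a) - (ry' + rz' * a)) - ((ry + rz * a) - (ry' + rz' * a))) * ↑(ha.unit⁻¹) ∈ I :=
        I.mul_mem_right _ (I.sub_mem (hI h) h)
      have hv : (σ ((ry + rz * a) - (ry' + rz' * a)) - ((ry + rz * a) - (ry' + rz' * a))) * ↑(ha.unit⁻¹) = rz - rz' := by
        rw [map_sub σ (ry + rz * a), show (σ (ry + rz * a) - σ (ry' + rz' * a) - (ry + rz * a - (ry' + rz' * a))) * ↑(ha.unit⁻¹) =
            (σ (ry + rz * a) - (ry + rz * a)) * ↑(ha.unit⁻¹) - (σ (ry' + rz' * a) - (ry' + rz' * a)) * ↑(ha.unit⁻¹) by ring,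
          vCoord_add_mul σ ha hry hrz, vCoord_add_mul σ ha hry' hrz']
      rw [hv] at hvI
      have hz_eq : Ideal.Quotient.mk I rz = Ideal.Quotient.mk I rz' := (Ideal.Quotient.eq).2 hvI
      have hy_eq : Ideal.Quotient.mk I ry = Ideal.Quotient.mk I ry' := by
        have h2 : (ry + rz * a) - (ry' + rz' * a) - (rz - rz') * a ∈ I := I.sub_mem h (I.mul_mem_right _ hvI)
        rw [Ideal.Quotient.eq]
        have e : ry - ry' = (ry + rz * a) - (ry' + rz' * a) - (rz - rz') * a := by ring
        rw [e]; exact h2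
      refine Prod.ext (Subtype.ext ?_) (Subtype.ext ?_)
      · show Ideal.Quotient.mk I y₀ = Ideal.Quotient.mk I y₀'
        rw [← ey, ← ey']; exact hy_eq
      · show Ideal.Quotient.mk I z₀ = Ideal.Quotient.mk I z₀'
        rw [← ez, ← ez']; exact hz_eq
    · intro q
      obtain ⟨x, rfl⟩ := Ideal.Quotient.mk_surjective q
      refine ⟨(⟨Ideal.Quotient.mk I (x - (σ x - x) * ↑(ha.unit⁻¹) * a), ?_⟩, ⟨Ideal.Quotient.mk I ((σ x - x) * ↑(ha.unit⁻¹)), ?_⟩), ?_⟩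
      · rw [hσq_mk, map_uCoord σ hσ ha]
      · rw [hσq_mk, map_vCoord σ hσ ha]
      · simp only [Ψ]
        rw [← map_mul, ← map_add, uCoord_add_vCoord_mul]
  rw [← Nat.card_eq_of_bijective Ψ hΨ, Nat.card_prod, pow_two]

end FixedPoints

section FixedPointsDVR

variable [IsDomain R] [IsDiscreteValuationRing R] (hσ : ∀ a, σ (σ a) = a) {a : R} (ha : IsUnit (σ a - a))
  {q : ℕ} (hq : Nat.card (ResidueField R) = q ^ 2)

include hσ ha hq in
/-- **`|Fix(σ̄_k)| = q^k`** on `R ⧸ 𝔪^k` when `|𝓀| = q²`: `|R ⧸ 𝔪^k| = q^{2k}` (§1) is the square of `|Fix(σ̄_k)|` (`natCard_quotient_eq_natCard_fixed_sq`).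
[cite: Serre1979, Ch. V §2 Prop. 2–3] -/
theorem natCard_fixed_quotient_pow (k : ℕ) :
    Nat.card {x : R ⧸ maximalIdeal R ^ k // Ideal.quotientMap (maximalIdeal R ^ k) σ (maximalIdeal_pow_le_comap σ hσ k) x = x} = q ^ k := by
  have h := natCard_quotient_eq_natCard_fixed_sq σ hσ ha (maximalIdeal_pow_le_comap σ hσ k)
  rw [natCard_quotient_maximalIdeal_pow, hq, ← pow_mul, mul_comm, pow_mul] at h
  exact (Nat.pow_left_injective two_ne_zero h).symm

end FixedPointsDVR

end Literature.NumberTheory.LocalFields.UnramifiedQuadraticNorm
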